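import Summits.ValiantsHypothesis.ValiantsHypothesis.Theorems.NewtonUnitEquationsTwoProductsTowerRecordDefs
import Summits.ValiantsHypothesis.ValiantsHypothesis.Theorems.NewtonUnitEquationsTwoProductsMomentRecordLiftModel

/-!
# R13 lift toolkit — the lumped free model of a TOWER alphabet `X ⊔ (X+d) ⊔ … ⊔ (X+D•d)`

(L1/3) The degree-`D` version of R12's lift model (✓ `…MomentRecordLiftModel`, whose generic part — `ιZ`, `pt`, `κw`, `ydeg`, `liftW`, the tuple
expansion `coeff_prod_one_add_liftW` — is imported BY NAME): tower letters `x_i + j•d` (`j ∈ E ⊆ [0, D]`) lift to the exponents `y_i z^j`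
(`yzExpT`), the alphabet hypothesis `TowerAlphabet u v x d E`, the letter lift `lamT`, lifted tails `ellUT`/`ellVT`/`DeltaUpT`, tower
dissociation in exponent form (`pt_injOn_towerShallow`: `pt` is injective on exponents with `ydeg ≤ m`, `z`-degree `≤ D·ydeg`), and UP = DOWN on
tuple classes under `TowerDissociated x d m D` (`coeff_deltaUpT_tupleExp`).
Helper on crux `stmt-ValiantsHypothesis-5906` (line `relation_ladder`, R13 «tower record law», texts ✓ `…TowerRecordDefs` (val-idea-37 g4 /
val-idea-crit-8 g2)); `--supports`, closes nothing by itself: the class rungs `TowerCarrierLaw` / `SparseLevelCarrierLaw ℓ` are WIDER CLASS rungs,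
inert as a hatch; `PlanarCellBound`, `ResidualLawV24` and the crux stay OPEN; VP ≠ VNP is NOT proved.  No instances, no notation, no named facts. [folklore]
-/

set_option linter.dupNamespace false

noncomputable section

open Classical

namespace Summit.ValiantsHypothesis.ValiantsHypothesis.Theorems.NewtonUnitEquations.TwoProducts.TowerRecord.Lift
open scoped BigOperators
open MvPolynomial
open Summit.ValiantsHypothesis.ValiantsHypothesis.Theorems.NewtonUnitEquations.TwoProducts.FormalLogLinearisation
open Summit.ValiantsHypothesis.ValiantsHypothesis.Theorems.NewtonUnitEquations.TwoProducts.PlanarCell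
open Summit.ValiantsHypothesis.ValiantsHypothesis.Theorems.NewtonUnitEquations.TwoProducts.MomentRecord
open Summit.ValiantsHypothesis.ValiantsHypothesis.Theorems.NewtonUnitEquations.TwoProducts.MomentRecord.Lift
open Summit.ValiantsHypothesis.ValiantsHypothesis.Theorems.NewtonUnitEquations.TwoProducts.TowerRecord

section ModelFile

variable {m n : ℕ}

/-! ## Tower letters and their exponents -/

/-- The tower letter `x_i + j•d` as an integer point. [folklore] -/
def towerPt (x : Fin n → Expo) (d : Fin 2 → ℤ) (i : Fin n) (j : ℕ) : Fin 2 → ℤ :=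
  fun c => ((x i c : ℕ) : ℤ) + (j : ℤ) * d c

/-- **TOWER ALPHABET with level set `E`**: every tail letter is `x_i + j•d` for a carrier `i` and a level `j ∈ E`
(the alphabet clause of `SparseLevelCarrierLaw`; `E = [0, D]` gives the clause of `TowerCarrierLaw`). [folklore] -/
def TowerAlphabet (u v : Fin m → MvPolynomial (Fin 2) ℂ) (x : Fin n → Expo) (d : Fin 2 → ℤ) (E : Finset ℕ) : Prop :=
  ∀ e ∈ tailSupport u v, ∃ i : Fin n, ∃ j ∈ E, ∀ c, ((e c : ℕ) : ℤ) = ((x i c : ℕ) : ℤ) + (j : ℤ) * d c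

/-- The alphabet clause of `TowerCarrierLaw` (`j ≤ D`) is the tower alphabet with `E = [0, D]`. [folklore] -/
theorem towerAlphabet_range_of_le {u v : Fin m → MvPolynomial (Fin 2) ℂ} {x : Fin n → Expo} {d : Fin 2 → ℤ} {D : ℕ}
    (h : ∀ e ∈ tailSupport u v, ∃ i : Fin n, ∃ j : ℕ, j ≤ D ∧ ∀ c, ((e c : ℕ) : ℤ) = ((x i c : ℕ) : ℤ) + (j : ℤ) * d c) :
    TowerAlphabet u v x d (Finset.range (D + 1)) := by
  intro e he
  obtain ⟨i, j, hj, hc⟩ := h e he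
  exact ⟨i, j, Finset.mem_range.mpr (Nat.lt_succ_of_le hj), hc⟩

/-- The exponent of the tower letter `x_i + j•d`: `y_i z^j`. [folklore] -/
def yzExpT (i : Fin n) (j : ℕ) : Option (Fin n) →₀ ℕ := Finsupp.single (some i) 1 + Finsupp.single none j

/-- `pt (y_i z^j) = x_i + j•d`. [folklore] -/
theorem pt_yzExpT (x : Fin n → Expo) (d : Fin 2 → ℤ) (i : Fin n) (j : ℕ) : pt x d (yzExpT i j) = towerPt x d i j := by
  classical
  ext c
  simp only [pt, yzExpT, towerPt, Finsupp.add_apply]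
  rw [Finset.sum_eq_single i (fun i' _ hi' => by simp [hi']) (by simp)]
  simp

/-- `ydeg (y_i z^j) = 1` and `(y_i z^j)(z) = j`. [folklore] -/
theorem ydeg_yzExpT (i : Fin n) (j : ℕ) : ydeg (yzExpT i j) = 1 ∧ yzExpT i j none = j := by
  classical
  refine ⟨?_, by simp [yzExpT]⟩
  simp only [ydeg, yzExpT, Finsupp.add_apply]
  rw [Finset.sum_eq_single i (fun i' _ hi' => by simp [hi']) (by simp)]
  simp

/-- The carrier coordinates of `y_i z^j`. [folklore] -/
theorem yzExpT_apply_some (i i' : Fin n) (j : ℕ) : yzExpT i j (some i') = if i' = i then 1 else 0 := by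
  classical
  simp only [yzExpT, Finsupp.add_apply, Finsupp.single_apply, Option.some.injEq, reduceCtorEq, if_false, add_zero]
  by_cases h : i' = i
  · rw [if_pos h, if_pos h.symm]
  · rw [if_neg h, if_neg (Ne.symm h)]

/-- `y_i z^j` determines `i` and `j`. [folklore] -/
theorem yzExpT_inj {i i' : Fin n} {j j' : ℕ} (h : yzExpT i j = yzExpT i' j') : i = i' ∧ j = j' := by
  constructor
  · have h1 := congrArg (fun E : Option (Fin n) →₀ ℕ => E (some i)) h
    simp only [yzExpT_apply_some, if_true] at h1
    by_contra hne
    rw [if_neg hne] at h1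
    exact one_ne_zero h1
  · have h1 := congrArg (fun E : Option (Fin n) →₀ ℕ => E none) h
    simpa [yzExpT] using h1

/-- TOWER DISSOCIATION in exponent form: `pt` is injective on exponents with `ydeg ≤ m` and `z`-degree `≤ D · ydeg`. [folklore] -/
theorem pt_injOn_towerShallow {x : Fin n → Expo} {d : Fin 2 → ℤ} {D : ℕ} (hdis : TowerDissociated x d m D)
    {E E' : Option (Fin n) →₀ ℕ} (hE : ydeg E ≤ m) (hk : E none ≤ D * ydeg E) (hE' : ydeg E' ≤ m) (hk' : E' none ≤ D * ydeg E')
    (h : pt x d E = pt x d E') : E = E' := by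
  rw [pt_eq_ptZ, pt_eq_ptZ] at h
  obtain ⟨hS, hkk⟩ := hdis _ _ _ _ hE hE' hk hk' h
  ext w
  cases w with
  | none => exact hkk
  | some i => exact congr_fun hS i

/-! ### Letters and their lifts -/

variable (u v : Fin m → MvPolynomial (Fin 2) ℂ) (x : Fin n → Expo) (d : Fin 2 → ℤ) (E : Finset ℕ)

/-- `Ex` is a TOWER LETTER EXPONENT of the tail letter `e`: `Ex = y_i z^j` with `e = x_i + j•d`, `j ∈ E`. [folklore] -/
def IsLetterExpT (e : Expo) (Ex : Option (Fin n) →₀ ℕ) : Prop :=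
  ∃ i : Fin n, ∃ j ∈ E, Ex = yzExpT i j ∧ ιZ e = towerPt x d i j

/-- The TOWER LETTER LIFT `λ`: a chosen letter exponent for tail letters, `0` elsewhere (in particular `λ 0 = 0`). [folklore] -/
def lamT (e : Expo) : Option (Fin n) →₀ ℕ :=
  if h : e ∈ tailSupport u v ∧ ∃ Ex, IsLetterExpT x d E e Ex then Classical.choose h.2 else 0

variable {u v x d E}

/-- Under the tower alphabet hypothesis every tail letter has a letter exponent. [folklore] -/
theorem exists_isLetterExpT (halph : TowerAlphabet u v x d E) {e : Expo} (he : e ∈ tailSupport u v) :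
    ∃ Ex, IsLetterExpT x d E e Ex := by
  obtain ⟨i, j, hj, h⟩ := halph e he
  exact ⟨yzExpT i j, i, j, hj, rfl, funext h⟩

/-- The lift of a tail letter is a letter exponent. [folklore] -/
theorem isLetterExpT_lamT (halph : TowerAlphabet u v x d E) {e : Expo} (he : e ∈ tailSupport u v) :
    IsLetterExpT x d E e (lamT u v x d E e) := by
  have h : e ∈ tailSupport u v ∧ ∃ Ex, IsLetterExpT x d E e Ex := ⟨he, exists_isLetterExpT halph he⟩
  rw [lamT, dif_pos h]
  exact Classical.choose_spec h.2

/-- Off the tail support the lift is `0`. [folklore] -/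
theorem lamT_of_not_mem {e : Expo} (he : e ∉ tailSupport u v) : lamT u v x d E e = 0 := by
  rw [lamT, dif_neg (fun h => he h.1)]

/-- A tower letter exponent projects to its letter, has one carrier letter, and its level lies in `E`. [folklore] -/
theorem IsLetterExpT.pt_eq {e : Expo} {Ex : Option (Fin n) →₀ ℕ} (h : IsLetterExpT x d E e Ex) :
    pt x d Ex = ιZ e ∧ ydeg Ex = 1 ∧ Ex none ∈ E := by
  obtain ⟨i, j, hj, rfl, he⟩ := h
  exact ⟨(pt_yzExpT x d i j).trans he.symm, (ydeg_yzExpT i j).1, by rw [(ydeg_yzExpT i j).2]; exact hj⟩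

/-- The lift projects back to the letter: `pt (λ e) = e` on `tailSupport ∪ {0}` (normalised instance). [folklore] -/
theorem pt_lamT (hu : ∀ j, coeff 0 (u j) = 0) (hv : ∀ j, coeff 0 (v j) = 0) (halph : TowerAlphabet u v x d E)
    {e : Expo} (he : e ∈ insert (0 : Expo) (tailSupport u v)) : pt x d (lamT u v x d E e) = ιZ e := by
  rcases Finset.mem_insert.mp he with rfl | he
  · rw [lamT_of_not_mem (zero_not_mem_tailSupport hu hv), pt_zero, ιZ_zero]
  · exact (isLetterExpT_lamT halph he).pt_eq.1

/-- Shape of the lift for levels `E ⊆ [0, D]`: `ydeg (λ e) ≤ 1` and `(λ e)(z) ≤ D · ydeg (λ e)`. [folklore] -/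
theorem ydeg_lamT_le (halph : TowerAlphabet u v x d E) {D : ℕ} (hED : ∀ j ∈ E, j ≤ D) (e : Expo) :
    ydeg (lamT u v x d E e) ≤ 1 ∧ (lamT u v x d E e) none ≤ D * ydeg (lamT u v x d E e) := by
  by_cases he : e ∈ tailSupport u v
  · obtain ⟨_, h1, h2⟩ := (isLetterExpT_lamT halph he).pt_eq
    refine ⟨h1.le, ?_⟩
    rw [h1, mul_one]
    exact hED _ h2
  · rw [lamT_of_not_mem he]
    simp [ydeg]

/-- Tuples of tower letters (`0` = no letter): the exponent `E_a = Σ_j λ(a_j)` of a tuple is TOWER-SHALLOW. [folklore] -/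
theorem shallow_tupleExpT (halph : TowerAlphabet u v x d E) {D : ℕ} (hED : ∀ j ∈ E, j ≤ D) (a : Fin m → Expo) :
    ydeg (∑ j, lamT u v x d E (a j)) ≤ m ∧
      (∑ j, lamT u v x d E (a j)) none ≤ D * ydeg (∑ j, lamT u v x d E (a j)) := by
  rw [ydeg_sum, Finsupp.finsetSum_apply]
  refine ⟨?_, ?_⟩
  · calc ∑ j, ydeg (lamT u v x d E (a j)) ≤ ∑ _j : Fin m, 1 := Finset.sum_le_sum fun j _ => (ydeg_lamT_le halph hED (a j)).1
      _ = m := by simp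
  · rw [Finset.mul_sum]
    exact Finset.sum_le_sum fun j _ => (ydeg_lamT_le halph hED (a j)).2

/-! ### Lifted tails and up = down on tuple classes -/

/-- The upstairs tails of the instance: `ℓU j = Σ_e [e]u_j Y^{λ e}`. [folklore] -/
def ellUT (j : Fin m) : MvPolynomial (Option (Fin n)) ℂ := liftW (lamT u v x d E) (u j)

/-- The upstairs `v`-tails. [folklore] -/
def ellVT (j : Fin m) : MvPolynomial (Option (Fin n)) ℂ := liftW (lamT u v x d E) (v j)

/-- The upstairs difference of products `𝚫 = ∏ (1 + ℓU_j) − ∏ (1 + ℓV_j)`. [folklore] -/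
def DeltaUpT : MvPolynomial (Option (Fin n)) ℂ :=
  ∏ j, (1 + ellUT (u := u) (v := v) (x := x) (d := d) (E := E) j) - ∏ j, (1 + ellVT (u := u) (v := v) (x := x) (d := d) (E := E) j)

/-- **Tower-dissociated comparison of fibres.** For a letter tuple `a`, the tuples with the same UPSTAIRS exponent are exactly the tuples
with the same DOWNSTAIRS point. [folklore] -/
theorem filter_tupleExp_eqT (hu : ∀ j, coeff 0 (u j) = 0) (hv : ∀ j, coeff 0 (v j) = 0)
    (halph : TowerAlphabet u v x d E) {D : ℕ} (hED : ∀ j ∈ E, j ≤ D) (hdis : TowerDissociated x d m D)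
    (A : Fin m → Finset Expo) (hA : ∀ j, A j ⊆ tailSupport u v) {a : Fin m → Expo}
    (ha : a ∈ Fintype.piFinset (fun j => insert 0 (A j))) :
    (Fintype.piFinset (fun j => insert 0 (A j))).filter (fun b => ∑ j, lamT u v x d E (b j) = ∑ j, lamT u v x d E (a j)) =
      (Fintype.piFinset (fun j => insert 0 (A j))).filter (fun b => ∑ j, b j = ∑ j, a j) := by
  classical
  have hmem : ∀ b ∈ Fintype.piFinset (fun j => insert 0 (A j)), ∀ j, b j ∈ insert (0 : Expo) (tailSupport u v) := by
    intro b hb j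
    have := Fintype.mem_piFinset.mp hb j
    rcases Finset.mem_insert.mp this with h | h
    · exact Finset.mem_insert.mpr (Or.inl h)
    · exact Finset.mem_insert_of_mem (hA j h)
  have hpt : ∀ b ∈ Fintype.piFinset (fun j => insert 0 (A j)), pt x d (∑ j, lamT u v x d E (b j)) = ιZ (∑ j, b j) := by
    intro b hb
    rw [pt_sum, ιZ_sum]
    exact Finset.sum_congr rfl fun j _ => pt_lamT hu hv halph (hmem b hb j)
  ext b
  simp only [Finset.mem_filter, and_congr_right_iff]
  intro hb
  constructor
  · intro h
    have := hpt b hb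
    rw [h, hpt a ha] at this
    exact ιZ_injective this.symm
  · intro h
    have h1 := hpt b hb
    rw [h, ← hpt a ha] at h1
    obtain ⟨s1, s2⟩ := shallow_tupleExpT halph hED b
    obtain ⟨t1, t2⟩ := shallow_tupleExpT halph hED a
    exact pt_injOn_towerShallow hdis s1 s2 t1 t2 h1

/-- **Up = down on tuple classes.** Under tower dissociation to depth `(m, D)` the upstairs coefficient of `𝚫` at a tuple exponent is the
downstairs coefficient of `tailDiff u v` at the tuple's point. [folklore] -/
theorem coeff_deltaUpT_tupleExp (hu : ∀ j, coeff 0 (u j) = 0) (hv : ∀ j, coeff 0 (v j) = 0)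
    (halph : TowerAlphabet u v x d E) {D : ℕ} (hED : ∀ j ∈ E, j ≤ D) (hdis : TowerDissociated x d m D)
    {a : Fin m → Expo} (ha : a ∈ Fintype.piFinset (fun _ : Fin m => insert (0 : Expo) (tailSupport u v))) :
    coeff (∑ j, lamT u v x d E (a j)) (DeltaUpT (u := u) (v := v) (x := x) (d := d) (E := E)) = coeff (∑ j, a j) (tailDiff u v) := by
  classical
  have h0 : (0 : Expo) ∉ tailSupport u v := zero_not_mem_tailSupport hu hv
  have hlam0 : lamT u v x d E 0 = 0 := lamT_of_not_mem h0
  have huA : ∀ j, (u j).support ⊆ tailSupport u v := fun j e he =>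
    Finset.mem_union_left _ (Finset.mem_biUnion.mpr ⟨j, Finset.mem_univ _, he⟩)
  have hvA : ∀ j, (v j).support ⊆ tailSupport u v := fun j e he =>
    Finset.mem_union_right _ (Finset.mem_biUnion.mpr ⟨j, Finset.mem_univ _, he⟩)
  have hfil := filter_tupleExp_eqT hu hv halph hED hdis (fun _ => tailSupport u v) (fun _ => le_rfl) ha
  rw [DeltaUpT, coeff_sub, tailDiff, coeff_sub]
  unfold ellUT ellVT
  rw [coeff_prod_one_add_liftW _ hlam0 u _ (fun _ => h0) huA, coeff_prod_one_add_liftW _ hlam0 v _ (fun _ => h0) hvA, hfil,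
    ← coeff_prod_one_add_eq_fibreSum u _ (fun _ => h0) huA, ← coeff_prod_one_add_eq_fibreSum v _ (fun _ => h0) hvA]

/-- Every upstairs exponent in the support of `𝚫` is a tuple exponent. [folklore] -/
theorem exists_tuple_of_coeff_deltaUpT_ne_zero (hu : ∀ j, coeff 0 (u j) = 0) (hv : ∀ j, coeff 0 (v j) = 0)
    {Ex : Option (Fin n) →₀ ℕ} (hE : coeff Ex (DeltaUpT (u := u) (v := v) (x := x) (d := d) (E := E)) ≠ 0) :
    ∃ a ∈ Fintype.piFinset (fun _ : Fin m => insert (0 : Expo) (tailSupport u v)), ∑ j, lamT u v x d E (a j) = Ex := by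
  classical
  have h0 : (0 : Expo) ∉ tailSupport u v := zero_not_mem_tailSupport hu hv
  have hlam0 : lamT u v x d E 0 = 0 := lamT_of_not_mem h0
  have huA : ∀ j, (u j).support ⊆ tailSupport u v := fun j e he =>
    Finset.mem_union_left _ (Finset.mem_biUnion.mpr ⟨j, Finset.mem_univ _, he⟩)
  have hvA : ∀ j, (v j).support ⊆ tailSupport u v := fun j e he =>
    Finset.mem_union_right _ (Finset.mem_biUnion.mpr ⟨j, Finset.mem_univ _, he⟩)
  by_contra hne
  push Not at hne
  apply hE
  rw [DeltaUpT, coeff_sub]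
  unfold ellUT ellVT
  rw [coeff_prod_one_add_liftW _ hlam0 u _ (fun _ => h0) huA, coeff_prod_one_add_liftW _ hlam0 v _ (fun _ => h0) hvA]
  have hempty : (Fintype.piFinset (fun _ : Fin m => insert (0 : Expo) (tailSupport u v))).filter
      (fun a => ∑ j, lamT u v x d E (a j) = Ex) = ∅ := by
    rw [Finset.filter_eq_empty_iff]
    exact fun a ha h => hne a ha h
  rw [hempty, Finset.sum_empty, Finset.sum_empty, sub_self]

end ModelFile

end Summit.ValiantsHypothesis.ValiantsHypothesis.Theorems.NewtonUnitEquations.TwoProducts.TowerRecord.Lift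

end
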